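/-
COR-CM (cell pub-hodgecm2 = stage 2 of the Hodge ladder), seat b26 gen 17 (prover-pub-hodgecm2-b26-g17-0, 2026-08-21);
count-neutral for the binder table (no row).  Companion of `Assembly/EllipticCurvePeriod`: the same period argument
for ABSTRACT weight-one Hodge structures of rank two — every effective one is a `V¹_τ`, hence polarisable, hence
(Riemann) the `H¹` of an elliptic curve.  Theorems only: no definition, no notation, no named fact, no instance.
-/
import Summits.HodgeConjecture.CorCM.Assembly.EllipticCurvePeriod
import HarnessLib

/-!
# Effective weight-one rational Hodge structures of rank two are the `V¹_τ`

Every complex torus of dimension one is an elliptic curve: a lattice `Λ ⊂ ℂ` is homothetic to `ℤ + τℤ` with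
`Im τ > 0`, and `E(x, y) = Im(x̄ y)/Im τ` is a Riemann form (Lange–Birkenhake §2.1, §4.2; Silverman AEC VI §3–5).
The Hodge-theoretic form of this statement, for the tree's filtration-style `ℚ`-Hodge structures
(`Motives.HodgeStructure`), is proved here: **every EFFECTIVE weight-one `ℚ`-Hodge structure `H` on a
`ℚ`-vector space of dimension `2` is isomorphic in `Hod_ℚ` to `V¹_τ = ofSplitting (ℂ ∙ ω_τ) _ one_pos` for some `τ`
with `Im τ > 0`** (`exists_periodHom_of_finrank_eq_two`; same two steps as for `H¹_B` of an elliptic curve in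
`Assembly/EllipticCurvePeriod`: transport along a `ℚ`-basis, `exists_hom_ofSplitting_of_map_F_one`, and the line
lemma `exists_period_of_isCompl`, with gen 16's `V¹_τ ≅ V¹_{-τ}` fixing the sign), hence

* `isPolarizable_of_finrank_eq_two` — **it is polarisable** (gen 15's polarisation of `V¹_τ` by the symplectic
  form, pulled back: in rank two the polarisability hypothesis of Riemann's theorem is automatic), and
* `exists_ellipticCurve_hom_of_finrank_eq_two` — **it is `H¹_B(E)` of a complex elliptic curve `E`** (Riemann's
  theorem, essential image, the tree's theorem `deligneMilne1982_Thm_6_20_essImage_holds`), so that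
* `exists_hom_bijective_iff_of_finrank_eq_two` — for two such structures with periods `τ, τ'` an isomorphism
  exists iff `τ' ∈ GL₂(ℚ) · τ` (gen 16's `exists_hom_bijective_iff`), and every non-zero morphism between
  effective weight-one rank-two structures is an isomorphism (`hom_bijective_of_ne_zero_of_finrank_eq_two`:
  they are simple objects of `Hod_ℚ`).

Effectivity cannot be dropped (re-index `V¹_τ` to types `(2,-1)`, `(-1,2)`: weight one, rank two, not
isomorphic to any `V¹_τ'`, cf. the Summits-side `riemannWeightOne_false_without_isEffective`).

HONEST SCOPE: linear algebra of rank-two Hodge structures plus Riemann's theorem as a tree theorem; nothing here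
bears on HC_CM or on the summit.

References: [LangeBirkenhake1992] §2.1, §4.2, Thm. 4.2.1 · [SilvermanAEC2009] VI §3–§5 · [VoisinHodgeI2002]
§7.1.2, §7.2.2 · [DeligneMilne1982Tannakian] LNM 900, art. II §6 Thm. 6.20 (Riemann), p. 212 ·
[MoonenZarhin1999LowDim] §2 (2.1), §3 Lemma (3.3).
-/

noncomputable section

open scoped TensorProduct
open CategoryTheory Module TensorProduct
open Literature.AlgebraicGeometry.Motives Literature.AlgebraicGeometry.HodgeTheory
open Literature.AlgebraicGeometry.Motives.HodgeStructure

namespace Summit.HodgeConjecture.CorCM.PeriodHodgeStructure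

universe u

section RankTwo

variable {V : Type u} [AddCommGroup V] [Module ℚ V]

/-- **Every effective weight-one `ℚ`-Hodge structure of rank two is a `V¹_τ`, `Im τ > 0`**: for `H` effective of
weight one on `V` with `dim_ℚ V = 2` there is `τ` with `Im τ > 0` such that, for every proof `hP` of the splitting
`ℂ ω_τ ⊕ ℂ ω̄_τ = ℂ²` (`ω_τ = 1 ⊗ e₀ + τ ⊗ e₁`), there is a morphism `H → ofSplitting (ℂ ∙ ω_τ) hP one_pos` with
bijective underlying map (an isomorphism in `Hod_ℚ`).  Hodge-theoretic «every lattice in `ℂ` is homothetic to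
`ℤ + τℤ`, `Im τ > 0`». [cite: LangeBirkenhake1992, §1.2 and Thm. 4.2.1] [cite: SilvermanAEC2009, VI §3–§5]
[cite: VoisinHodgeI2002, §7.2.2] -/
theorem exists_periodHom_of_finrank_eq_two (H : HodgeStructure V 1) (heff : H.IsEffective)
    (hV : Module.finrank ℚ V = 2) :
    ∃ τ : ℂ, 0 < τ.im ∧
      ∀ hP : IsCompl (ℂ ∙ ((1 : ℂ) ⊗ₜ[ℚ] (Pi.single 0 1 : Fin 2 → ℚ) + τ ⊗ₜ[ℚ] Pi.single 1 1))
          (complexConj (ℂ ∙ ((1 : ℂ) ⊗ₜ[ℚ] (Pi.single 0 1 : Fin 2 → ℚ) + τ ⊗ₜ[ℚ] Pi.single 1 1))),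
        ∃ f : Hom H (ofSplitting (ℂ ∙ ((1 : ℂ) ⊗ₜ[ℚ] (Pi.single 0 1 : Fin 2 → ℚ) + τ ⊗ₜ[ℚ] Pi.single 1 1))
            hP one_pos : HodgeStructure (Fin 2 → ℚ) 1),
          Function.Bijective f.toLinearMap := by
  haveI : Module.Finite ℚ V := Module.finite_of_finrank_eq_succ hV
  let φ : V ≃ₗ[ℚ] (Fin 2 → ℚ) := (Module.finBasisOfFinrankEq ℚ V hV).equivFun
  set L : Submodule ℂ (ℂ ⊗[ℚ] (Fin 2 → ℚ)) := (H.F 1).map (φ.toLinearMap.baseChange ℂ) with hL_def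
  have hPL : IsCompl L (complexConj L) :=
    PeriodCurve.isCompl_map_baseChange φ (H.isCompl_F_complexConj 1 1 (by norm_num))
  obtain ⟨τ₀, hτ₀, hL⟩ := exists_period_of_isCompl L hPL
  obtain ⟨h0, h1⟩ := PeriodCurve.coords_periodVector τ₀
  have hP₀ := isCompl_span h0 h1 hτ₀
  obtain ⟨f₀, hf₀⟩ := PeriodCurve.exists_hom_ofSplitting_of_map_F_one H heff φ _ hL hP₀
  have hbij₀ : Function.Bijective f₀.toLinearMap := by rw [hf₀]; exact φ.bijective
  rcases lt_or_gt_of_ne hτ₀ with hneg | hpos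
  · refine ⟨-τ₀, by simpa using hneg, fun hP => ?_⟩
    obtain ⟨h0', h1'⟩ := PeriodCurve.coords_periodVector (-τ₀)
    obtain ⟨S, hS⟩ := exists_hom_bijective_ratCast_mul h0 h1 h0' h1' hP₀ hP hτ₀ (-1) (by push_cast; ring)
    exact ⟨S.comp f₀, hS.comp hbij₀⟩
  · exact ⟨τ₀, hpos, fun hP => ⟨f₀, hbij₀⟩⟩

/-- **Every effective weight-one `ℚ`-Hodge structure of rank two is polarisable** (it is a `V¹_τ` with
`Im τ > 0`, polarised by the symplectic form `x₀ y₁ − x₁ y₀`, gen 15's `isPolarizable`; polarisations pull back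
along isomorphisms of `Hod_ℚ`).  In rank two the polarisability hypothesis of Riemann's theorem is automatic —
«every one-dimensional complex torus is an abelian variety». [cite: LangeBirkenhake1992, §2.1 and §4.2]
[cite: VoisinHodgeI2002, §7.1.2 and §7.2.2] -/
theorem isPolarizable_of_finrank_eq_two (H : HodgeStructure V 1) (heff : H.IsEffective)
    (hV : Module.finrank ℚ V = 2) : H.IsPolarizable := by
  obtain ⟨τ, hτ, h⟩ := exists_periodHom_of_finrank_eq_two H heff hV
  obtain ⟨h0, h1⟩ := PeriodCurve.coords_periodVector τ
  have hP := isCompl_span h0 h1 hτ.ne'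
  obtain ⟨f, hf⟩ := h hP
  exact ((f.symmOfBijective hf).isPolarizable_and_isEffective_of_bijective (f.symmOfBijective_bijective hf)
    (isPolarizable h0 h1 hP hτ) (isEffective hP)).1

/-- **A non-zero morphism between effective weight-one `ℚ`-Hodge structures of rank two is an isomorphism**
(both are `V¹_τ`'s; gen 16's `hom_bijective_of_ne_zero`): such structures are simple objects of `Hod_ℚ`.
[cite: MoonenZarhin1999LowDim, §3 Lemma (3.3)] [cite: DeligneHodgeII1971, Thm. 2.3.5(iii)] -/
theorem hom_bijective_of_ne_zero_of_finrank_eq_two {W : Type u} [AddCommGroup W] [Module ℚ W]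
    (H : HodgeStructure V 1) (heff : H.IsEffective) (hV : Module.finrank ℚ V = 2)
    (H' : HodgeStructure W 1) (heff' : H'.IsEffective) (hW : Module.finrank ℚ W = 2)
    (T : Hom H H') (hT : T.toLinearMap ≠ 0) : Function.Bijective T.toLinearMap := by
  obtain ⟨τ, hτ, h⟩ := exists_periodHom_of_finrank_eq_two H heff hV
  obtain ⟨τ', hτ', h'⟩ := exists_periodHom_of_finrank_eq_two H' heff' hW
  obtain ⟨h0, h1⟩ := PeriodCurve.coords_periodVector τ
  obtain ⟨h0', h1'⟩ := PeriodCurve.coords_periodVector τ'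
  have hP := isCompl_span h0 h1 hτ.ne'
  have hP' := isCompl_span h0' h1' hτ'.ne'
  obtain ⟨f, hf⟩ := h hP
  obtain ⟨f', hf'⟩ := h' hP'
  -- `S = f' ∘ T ∘ f⁻¹ : V¹_τ → V¹_τ'` is non-zero, hence bijective
  set S := f'.comp (T.comp (f.symmOfBijective hf)) with hS_def
  have hS : S.toLinearMap ≠ 0 := by
    intro hS0
    apply hT
    refine LinearMap.ext fun v => ?_
    have hv := LinearMap.congr_fun hS0 (f.toLinearMap v)
    change f'.toLinearMap (T.toLinearMap ((f.symmOfBijective hf).toLinearMap (f.toLinearMap v))) = 0 at hv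
    rw [Hom.symmOfBijective_apply_apply] at hv
    rw [LinearMap.zero_apply]
    exact hf'.1 (by rw [hv, map_zero])
  have hSb := hom_bijective_of_ne_zero h0 h1 h0' h1' hP hP' hτ.ne' S hS
  -- `T = f'⁻¹ ∘ S ∘ f`
  have hT' : T.toLinearMap = (f'.symmOfBijective hf').toLinearMap ∘ₗ S.toLinearMap ∘ₗ f.toLinearMap := by
    refine LinearMap.ext fun v => ?_
    change T.toLinearMap v = (f'.symmOfBijective hf').toLinearMap
      (f'.toLinearMap (T.toLinearMap ((f.symmOfBijective hf).toLinearMap (f.toLinearMap v))))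
    rw [Hom.symmOfBijective_apply_apply, Hom.symmOfBijective_apply_apply]
  rw [hT']
  exact (f'.symmOfBijective_bijective hf').comp (hSb.comp hf)

end RankTwo

section RankTwoRiemann

variable {V : Type} [AddCommGroup V] [Module ℚ V]

/-- **Every effective weight-one `ℚ`-Hodge structure of rank two is `H¹` of a complex elliptic curve**: there
are a complex abelian variety `E` of dimension `1`, a Hodge symmetric model `B` and an isomorphism `H¹_B(E) ≅ H`
in `Hod_ℚ` (Riemann's theorem, essential image — the tree's theorem `deligneMilne1982_Thm_6_20_essImage_holds` —
at the automatic polarisability `isPolarizable_of_finrank_eq_two`).  «Every one-dimensional complex torus is an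
elliptic curve.» [cite: DeligneMilne1982Tannakian, art. II §6 Thm. 6.20 (Riemann), LNM 900 p. 212]
[cite: LangeBirkenhake1992, §2.1, §4.2 and Thm. 4.2.1] [cite: SilvermanAEC2009, VI §3–§5] -/
theorem exists_ellipticCurve_hom_of_finrank_eq_two (H : HodgeStructure V 1) (heff : H.IsEffective)
    (hV : Module.finrank ℚ V = 2) :
    ∃ (E : AbelianVariety ℂ) (B : HodgeModel E.dim E.X) (hB : B.IsHodgeSymmetric)
      (g : Hom (bettiOneHodgeStructure E B hB) H), Function.Bijective g.toLinearMap ∧ E.dim = 1 := by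
  haveI : Module.Finite ℚ V := Module.finite_of_finrank_eq_succ hV
  obtain ⟨E, B, hB, g, hg⟩ :=
    deligneMilne1982_Thm_6_20_essImage_holds H (isPolarizable_of_finrank_eq_two H heff hV) heff
  refine ⟨E, B, hB, g, hg, ?_⟩
  have h := NonCMCurve.two_mul_dim_eq_finrank g hg
  omega

/-- **Classification of effective weight-one rank-two `ℚ`-Hodge structures up to isomorphism**: `H`, `H'` have
periods `τ, τ'` in the upper half plane (`H ≅ V¹_τ`, `H' ≅ V¹_τ'`), and `H ≅ H'` in `Hod_ℚ` iff
`τ' (a + bτ) = c + dτ` for rationals with `a + bτ ≠ 0`, i.e. `τ' ∈ GL₂(ℚ) · τ` (gen 16's `exists_hom_bijective_iff`)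
— the upper half plane modulo `GL₂(ℚ)⁺`. [cite: MoonenZarhin1999LowDim, §3 Lemma (3.3)]
[cite: SilvermanAEC2009, VI §4 Thm. 4.1 and §5] -/
theorem exists_periods_hom_bijective_iff_of_finrank_eq_two {W : Type} [AddCommGroup W] [Module ℚ W]
    (H : HodgeStructure V 1) (heff : H.IsEffective) (hV : Module.finrank ℚ V = 2)
    (H' : HodgeStructure W 1) (heff' : H'.IsEffective) (hW : Module.finrank ℚ W = 2) :
    ∃ τ τ' : ℂ, 0 < τ.im ∧ 0 < τ'.im ∧
      (∃ (P : HodgeStructure (Fin 2 → ℚ) 1) (f : Hom H P), Function.Bijective f.toLinearMap ∧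
        P.F 1 = ℂ ∙ ((1 : ℂ) ⊗ₜ[ℚ] (Pi.single 0 1 : Fin 2 → ℚ) + τ ⊗ₜ[ℚ] Pi.single 1 1)) ∧
      (∃ (P' : HodgeStructure (Fin 2 → ℚ) 1) (f' : Hom H' P'), Function.Bijective f'.toLinearMap ∧
        P'.F 1 = ℂ ∙ ((1 : ℂ) ⊗ₜ[ℚ] (Pi.single 0 1 : Fin 2 → ℚ) + τ' ⊗ₜ[ℚ] Pi.single 1 1)) ∧
      ((∃ T : Hom H H', Function.Bijective T.toLinearMap) ↔
        ∃ a b c d : ℚ, (a : ℂ) + b * τ ≠ 0 ∧ τ' * (a + b * τ) = c + d * τ) := by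
  obtain ⟨τ, hτ, h⟩ := exists_periodHom_of_finrank_eq_two H heff hV
  obtain ⟨τ', hτ', h'⟩ := exists_periodHom_of_finrank_eq_two H' heff' hW
  obtain ⟨h0, h1⟩ := PeriodCurve.coords_periodVector τ
  obtain ⟨h0', h1'⟩ := PeriodCurve.coords_periodVector τ'
  have hP := isCompl_span h0 h1 hτ.ne'
  have hP' := isCompl_span h0' h1' hτ'.ne'
  obtain ⟨f, hf⟩ := h hP
  obtain ⟨f', hf'⟩ := h' hP'
  refine ⟨τ, τ', hτ, hτ', ⟨_, f, hf, F_one hP⟩, ⟨_, f', hf', F_one hP'⟩, ?_⟩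
  rw [← exists_hom_bijective_iff h0 h1 h0' h1' hP hP' hτ.ne']
  constructor
  · rintro ⟨T, hT⟩
    exact ⟨f'.comp (T.comp (f.symmOfBijective hf)), hf'.comp (hT.comp (f.symmOfBijective_bijective hf))⟩
  · rintro ⟨S, hS⟩
    exact ⟨(f'.symmOfBijective hf').comp (S.comp f), (f'.symmOfBijective_bijective hf').comp (hS.comp hf)⟩

end RankTwoRiemann

end Summit.HodgeConjecture.CorCM.PeriodHodgeStructure

end
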